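import Literature.AnabelianGeometry.SemiGraphs.AmbientCategory
import Literature.AnabelianGeometry.SemiGraphs.InducedAlong

/-!
# Pull-backs along immersions inherit injective type, total aloofness, total estrangement ([SemiAnbd] §2, Def 2.1 / 2.4 (iv); §4 Def 4.1) — merge step M4, part 4

Mochizuki, *Semi-graphs of anabelioids*, Publ. RIMS **42** (2006), §2 Def 2.1 p.22 (injective type),
Def 2.4 (iv) p.26 (aloof / estranged edges), §4 Def 4.1 p.50 (`𝒢[v]`, `𝒢[e]`, `𝒢[b]`) (kurims
`paper:url-f33ace170ff4`). [cite: MochizukiSemiAnbd2006, Def 4.1, p. 50]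

PROOF-ONLY bookkeeping for the L3 bridge (cell ruling abc-iut-L3-lead 2026-08-25T20:36Z, step M4):
§4 opens with "Let `𝒢` be a totally aloof, verticially slim semi-graph of anabelioids" and then
works with `𝒢[v]`, `𝒢[e]`, `𝒢[b]` as objects of the same ambient category (Rmk 2.4.2; `SgA` of
`AmbientCategory.lean`).  That these localizations ARE again totally aloof (and of injective type,
resp. totally estranged, when `𝒢` is) is used silently in print; here it is proved, in the natural
generality of the pull-back `𝒢.inducedAlong ι` of `InducedAlong.lean` along a morphism of
semi-graphs `ι : H → 𝔾`:

* `inducedAlong_isOfInjectiveType` — for ANY `ι` (the branch morphisms of `𝒢_H` are those of `𝒢`);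
* `inducedAlong_edgeIntersectionCondition` — the intersection condition of Def 2.4 (iv) at an edge
  `e` of `H` follows from the one of `𝒢` at `ι e` as soon as `ι` is an IMMERSION (injective on the
  branches at each vertex, §1 p.13: distinct branches at `w` stay distinct at `ι w`; the vertex
  groups `Π_{ι w}` and the subgroups `Π_b` are literally those of `𝒢`), whence
  `inducedAlong_isTotallyAloof`, `inducedAlong_isTotallyEstranged`;
* the instances at t1's `𝔾[v] → 𝔾` (an excision), `𝔾[e] → 𝔾`, `𝔾[b] → 𝔾` (immersions,
  `SemiGraphLocal.lean`): `atVertex_isTotallyAloof`, …, and `atVertex_isAmbientObj` etc. — the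
  three conjuncts of `SgAQuot.IsAmbientObj` (totally aloof ∧ verticially slim ∧ every edge abuts).

Technique (as in `InducedAlong.lean`): the branch morphism of `𝒢_H` at `c` is `(ι c)_*` composed with
an identity transported along `𝔾.edgeOf (ι c) = ι (H.edgeOf c)`; every statement is first proved for
a VARIABLE presentation of that edge and the transported functor (`subst`), then specialised.
Nothing printed is asserted; no definition is introduced.
-/

namespace Literature.AnabelianGeometry.SemiGraphs

open CategoryTheory CategoryTheory.PreGaloisCategory Literature.AnabelianGeometry.Anabelioids
open scoped Pointwise

universe v₁ u₁ u

namespace SemiGraphOfAnabelioids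

variable (𝒢 : SemiGraphOfAnabelioids.{v₁, u₁, u}) {H : SemiGraph.{u}} (ι : H ⟶ 𝒢.graph)

/-! ### The branch data of a pull-back, over a variable presentation of the edge -/

/-- Over a variable presentation `E₀ = 𝔾.edgeOf b` of the edge and a variable functor `Q` equal to
`b^*` followed by the transported identity: `Q` is a `π₁`-monomorphism iff `b^*` is.
[cite: MochizukiSemiAnbd2006, Def. 2.1 p.22] -/
theorem isPi1Mono_of_eq_pull_comp_idE {v : 𝒢.graph.Vertex} (b : 𝒢.graph.Branch)
    (h : 𝒢.graph.abuts b = some v) {E₀ : 𝒢.graph.Edge} (p : E₀ = 𝒢.graph.edgeOf b)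
    (Q : 𝒢.V v ⥤ 𝒢.E E₀) (hQ : Q = (𝒢.pull b v h).pullback ⋙ (𝒢.idE E₀ _ p).pullback)
    (hb : IsPi1Mono (𝒢.pull b v h).pullback) : IsPi1Mono Q := by
  subst p
  have hQ' : Q = (𝒢.pull b v h).pullback := by
    rw [hQ, idE_rfl]
    exact Functor.comp_id _
  subst hQ'
  exact hb

/-- Over a variable presentation `E₀ = 𝔾.edgeOf b` of the edge and a variable functor `Q` equal to
`b^*` followed by the transported identity: the "branch subgroup" computed from `Q` and a basepoint
`Fe` of `𝒢_{E₀}` IS a branch subgroup `Π_b ⊆ Π_v` of `𝒢` for a suitable basepoint of `𝒢_{𝔾.edgeOf b}`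
(after `subst`, the same one). [cite: MochizukiSemiAnbd2006, Def. 2.1 pp.23-24] -/
theorem exists_branchSubgroup_eq_of_eq_pull_comp_idE {v : 𝒢.graph.Vertex}
    (F : 𝒢.V v ⥤ FintypeCat.{v₁}) (b : 𝒢.graph.Branch) (h : 𝒢.graph.abuts b = some v)
    {E₀ : 𝒢.graph.Edge} (p : E₀ = 𝒢.graph.edgeOf b) (Q : 𝒢.V v ⥤ 𝒢.E E₀)
    (hQ : Q = (𝒢.pull b v h).pullback ⋙ (𝒢.idE E₀ _ p).pullback)
    (Fe : 𝒢.E E₀ ⥤ FintypeCat.{v₁}) [FiberFunctor Fe] (α : Q ⋙ Fe ≅ F) :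
    ∃ (Fe' : 𝒢.E (𝒢.graph.edgeOf b) ⥤ FintypeCat.{v₁}) (_ : FiberFunctor Fe')
      (α' : (𝒢.pull b v h).pullback ⋙ Fe' ≅ F),
      ((Aut.autMulEquivOfIso α).toMonoidHom.comp (pi1Map Q Fe)).range =
        𝒢.branchSubgroup F b h Fe' α' := by
  subst p
  have hQ' : Q = (𝒢.pull b v h).pullback := by
    rw [hQ, idE_rfl]
    exact Functor.comp_id _
  subst hQ'
  exact ⟨Fe, inferInstance, α, rfl⟩

/-! ### Injective type -/

/-- **Pull-backs are of injective type** when `𝒢` is: the branch morphisms of `𝒢_H` are those of `𝒢`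
(up to a transported identity). [cite: MochizukiSemiAnbd2006, Def. 2.1 p.22] -/
theorem inducedAlong_isOfInjectiveType (h𝒢 : 𝒢.IsOfInjectiveType) :
    (𝒢.inducedAlong ι).IsOfInjectiveType := by
  refine ⟨fun c w hc => ?_⟩
  exact 𝒢.isPi1Mono_of_eq_pull_comp_idE (ι.branchMap c) (ι.abuts_branchMap c w hc)
    (ι.edgeOf_branchMap c).symm _ rfl (h𝒢.isPi1Mono _ _ _)

/-! ### The intersection condition of Def 2.4 (iv) along an immersion -/

/-- An immersion separates distinct branches at a vertex: `c ≠ c'` abutting to `w` have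
`ι c ≠ ι c'`. [cite: MochizukiSemiAnbd2006, §1 p.14] -/
theorem branchMap_ne_of_isImmersion (hι : SemiGraph.IsImmersion ι) {w : H.Vertex}
    {c c' : H.Branch} (hc : H.abuts c = some w) (hc' : H.abuts c' = some w) (hne : c' ≠ c) :
    ι.branchMap c' ≠ ι.branchMap c := by
  intro heq
  apply hne
  have := hι w (a₁ := ⟨c', hc'⟩) (a₂ := ⟨c, hc⟩) (Subtype.ext heq)
  exact congrArg Subtype.val this

/-- **The intersection condition of Def 2.4 (iv) is inherited by pull-backs along immersions**: for
an immersion `ι : H → 𝔾` and an edge `e` of `H`, the condition for `𝒢` at `ι e` (at any strength `P`)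
implies the condition for `𝒢_H = 𝒢.inducedAlong ι` at `e` — the vertex groups and branch subgroups
of `𝒢_H` are those of `𝒢`, and distinct branches at a vertex of `H` stay distinct in `𝔾`.
[cite: MochizukiSemiAnbd2006, Def. 2.4(iv) p.26] -/
theorem inducedAlong_edgeIntersectionCondition (hι : SemiGraph.IsImmersion ι)
    (P : ∀ {Γ : Type (max u₁ v₁)} [Group Γ], Subgroup Γ → Subgroup Γ → Prop) (e : H.Edge)
    (h𝒢 : 𝒢.EdgeIntersectionCondition (ι.edgeMap e) P) :
    (𝒢.inducedAlong ι).EdgeIntersectionCondition e P := by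
  intro c hce w hc F _ Fe _ α
  -- the branch subgroup of `𝒢_H` at `c` is a branch subgroup of `𝒢` at `ι c`
  obtain ⟨Fe', inst', α', hB⟩ := 𝒢.exists_branchSubgroup_eq_of_eq_pull_comp_idE F (ι.branchMap c)
    (ι.abuts_branchMap c w hc) (ι.edgeOf_branchMap c).symm _ rfl Fe α
  have hB' : (𝒢.inducedAlong ι).branchSubgroup F c hc Fe α =
      𝒢.branchSubgroup F (ι.branchMap c) (ι.abuts_branchMap c w hc) Fe' α' := hB
  have he : 𝒢.graph.edgeOf (ι.branchMap c) = ι.edgeMap e := by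
    rw [ι.edgeOf_branchMap, hce]
  obtain ⟨h₁, h₂⟩ := h𝒢 (ι.branchMap c) he (ι.vertexMap w) (ι.abuts_branchMap c w hc) F Fe' α'
  refine ⟨fun c' hc' Fe₁ _ α₁ g hne => ?_, fun g hg => ?_⟩
  · obtain ⟨Fe₁', inst₁', α₁', hB₁⟩ := 𝒢.exists_branchSubgroup_eq_of_eq_pull_comp_idE F
      (ι.branchMap c') (ι.abuts_branchMap c' w hc') (ι.edgeOf_branchMap c').symm _ rfl Fe₁ α₁
    have hB₁' : (𝒢.inducedAlong ι).branchSubgroup F c' hc' Fe₁ α₁ =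
        𝒢.branchSubgroup F (ι.branchMap c') (ι.abuts_branchMap c' w hc') Fe₁' α₁' := hB₁
    rw [hB', hB₁']
    exact h₁ (ι.branchMap c') (ι.abuts_branchMap c' w hc') Fe₁' α₁' g
      (𝒢.branchMap_ne_of_isImmersion ι hι hc hc' hne)
  · rw [hB'] at hg ⊢
    exact h₂ g hg

/-- **Pull-backs along immersions are totally aloof** when `𝒢` is (§4 p.50 uses `𝒢[v]`, `𝒢[e]`,
`𝒢[b]` as objects of the ambient category of totally aloof semi-graphs of anabelioids).
[cite: MochizukiSemiAnbd2006, Def. 2.4(iv) p.26] -/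
theorem inducedAlong_isTotallyAloof (hι : SemiGraph.IsImmersion ι) (h𝒢 : 𝒢.IsTotallyAloof) :
    (𝒢.inducedAlong ι).IsTotallyAloof :=
  ⟨fun e => 𝒢.inducedAlong_edgeIntersectionCondition ι hι _ e (h𝒢.isAloof (ι.edgeMap e))⟩

/-- **Pull-backs along immersions are totally estranged** when `𝒢` is.
[cite: MochizukiSemiAnbd2006, Def. 2.4(iv) p.26] -/
theorem inducedAlong_isTotallyEstranged (hι : SemiGraph.IsImmersion ι)
    (h𝒢 : 𝒢.IsTotallyEstranged) : (𝒢.inducedAlong ι).IsTotallyEstranged :=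
  ⟨fun e => 𝒢.inducedAlong_edgeIntersectionCondition ι hι _ e (h𝒢.isEstranged (ι.edgeMap e))⟩

/-- Aloofness of a single edge is inherited: an edge `e` of `H` over an aloof edge of `𝔾` is aloof in
`𝒢_H` (immersion `ι`). [cite: MochizukiSemiAnbd2006, Def. 2.4(iv) p.26] -/
theorem inducedAlong_isAloof (hι : SemiGraph.IsImmersion ι) (e : H.Edge)
    (h𝒢 : 𝒢.IsAloof (ι.edgeMap e)) : (𝒢.inducedAlong ι).IsAloof e :=
  𝒢.inducedAlong_edgeIntersectionCondition ι hι _ e h𝒢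

/-- Estrangement of a single edge is inherited: an edge `e` of `H` over an estranged edge of `𝔾` is
estranged in `𝒢_H` (immersion `ι`). [cite: MochizukiSemiAnbd2006, Def. 2.4(iv) p.26] -/
theorem inducedAlong_isEstranged (hι : SemiGraph.IsImmersion ι) (e : H.Edge)
    (h𝒢 : 𝒢.IsEstranged (ι.edgeMap e)) : (𝒢.inducedAlong ι).IsEstranged e :=
  𝒢.inducedAlong_edgeIntersectionCondition ι hι _ e h𝒢

/-! ### The localizations `𝒢[v]`, `𝒢[e]`, `𝒢[b]` (Def 4.1) -/

/-- `𝒢[v]` is of injective type when `𝒢` is. [cite: MochizukiSemiAnbd2006, Def 4.1, p. 50] -/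
theorem atVertex_isOfInjectiveType (h𝒢 : 𝒢.IsOfInjectiveType) (v : 𝒢.graph.Vertex) :
    (𝒢.atVertex v).IsOfInjectiveType :=
  𝒢.inducedAlong_isOfInjectiveType _ h𝒢

/-- `𝒢[e]` is of injective type when `𝒢` is. [cite: MochizukiSemiAnbd2006, Def 4.1, p. 50] -/
theorem atEdge_isOfInjectiveType (h𝒢 : 𝒢.IsOfInjectiveType) (e : 𝒢.graph.Edge) :
    (𝒢.atEdge e).IsOfInjectiveType :=
  𝒢.inducedAlong_isOfInjectiveType _ h𝒢

/-- `𝒢[b]` is of injective type when `𝒢` is. [cite: MochizukiSemiAnbd2006, Def 4.1, p. 50] -/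
theorem atBranch_isOfInjectiveType (h𝒢 : 𝒢.IsOfInjectiveType) (b : 𝒢.graph.Branch)
    (hb : (𝒢.graph.abuts b).isSome) : (𝒢.atBranch b hb).IsOfInjectiveType :=
  𝒢.inducedAlong_isOfInjectiveType _ h𝒢

/-- `𝒢[v]` is totally aloof when `𝒢` is (`𝔾[v] → 𝔾` is an excision, hence an immersion).
[cite: MochizukiSemiAnbd2006, Def 4.1, p. 50] -/
theorem atVertex_isTotallyAloof (h𝒢 : 𝒢.IsTotallyAloof) (v : 𝒢.graph.Vertex) :
    (𝒢.atVertex v).IsTotallyAloof :=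
  𝒢.inducedAlong_isTotallyAloof _ (𝒢.graph.atVertexHom_isExcision v).isImmersion h𝒢

/-- `𝒢[e]` is totally aloof when `𝒢` is (`𝔾[e] → 𝔾` is an immersion).
[cite: MochizukiSemiAnbd2006, Def 4.1, p. 50] -/
theorem atEdge_isTotallyAloof (h𝒢 : 𝒢.IsTotallyAloof) (e : 𝒢.graph.Edge) :
    (𝒢.atEdge e).IsTotallyAloof :=
  𝒢.inducedAlong_isTotallyAloof _ (𝒢.graph.atEdgeHom_isImmersion e) h𝒢

/-- `𝒢[b]` is totally aloof when `𝒢` is (`𝔾[b] → 𝔾` is an immersion).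
[cite: MochizukiSemiAnbd2006, Def 4.1, p. 50] -/
theorem atBranch_isTotallyAloof (h𝒢 : 𝒢.IsTotallyAloof) (b : 𝒢.graph.Branch)
    (hb : (𝒢.graph.abuts b).isSome) : (𝒢.atBranch b hb).IsTotallyAloof :=
  𝒢.inducedAlong_isTotallyAloof _ (𝒢.graph.atBranchHom_isImmersion b hb) h𝒢

/-- `𝒢[v]` is totally estranged when `𝒢` is. [cite: MochizukiSemiAnbd2006, Def 4.1, p. 50] -/
theorem atVertex_isTotallyEstranged (h𝒢 : 𝒢.IsTotallyEstranged) (v : 𝒢.graph.Vertex) :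
    (𝒢.atVertex v).IsTotallyEstranged :=
  𝒢.inducedAlong_isTotallyEstranged _ (𝒢.graph.atVertexHom_isExcision v).isImmersion h𝒢

/-- `𝒢[e]` is totally estranged when `𝒢` is. [cite: MochizukiSemiAnbd2006, Def 4.1, p. 50] -/
theorem atEdge_isTotallyEstranged (h𝒢 : 𝒢.IsTotallyEstranged) (e : 𝒢.graph.Edge) :
    (𝒢.atEdge e).IsTotallyEstranged :=
  𝒢.inducedAlong_isTotallyEstranged _ (𝒢.graph.atEdgeHom_isImmersion e) h𝒢

/-- `𝒢[b]` is totally estranged when `𝒢` is. [cite: MochizukiSemiAnbd2006, Def 4.1, p. 50] -/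
theorem atBranch_isTotallyEstranged (h𝒢 : 𝒢.IsTotallyEstranged) (b : 𝒢.graph.Branch)
    (hb : (𝒢.graph.abuts b).isSome) : (𝒢.atBranch b hb).IsTotallyEstranged :=
  𝒢.inducedAlong_isTotallyEstranged _ (𝒢.graph.atBranchHom_isImmersion b hb) h𝒢

end SemiGraphOfAnabelioids

/-! ### Objects of the ambient category `SgA` -/

namespace SgAQuot

open SemiGraphOfAnabelioids

/-- The object of the Rmk 2.4.2 category with locally open arrows underlying a semi-graph of
anabelioids (bookkeeping: `SgALocOpen` is a wide subcategory of `SgAQuot`).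
[cite: MochizukiSemiAnbd2006, Rmk 2.4.2, p. 26] -/
theorem isAmbientObj_iff (X : SgALocOpen.{v₁, u₁, u}) :
    IsAmbientObj X ↔ X.obj.toSgA.IsTotallyAloof ∧ X.obj.toSgA.IsVerticiallySlim ∧
      X.obj.toSgA.EveryEdgeAbuts :=
  Iff.rfl

/-- A pull-back `𝒢_H` of an ambient object along an immersion `ι : H → 𝔾` under which every edge of
`H` abuts to a vertex is again an ambient object (totally aloof ∧ verticially slim ∧ every edge
abuts). [cite: MochizukiSemiAnbd2006, Rmk 2.4.2, p. 26] -/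
theorem isAmbientObj_inducedAlong (𝒢 : SemiGraphOfAnabelioids.{v₁, u₁, u}) {H : SemiGraph.{u}}
    (ι : H ⟶ 𝒢.graph) (hι : SemiGraph.IsImmersion ι) (hA : 𝒢.IsTotallyAloof)
    (hS : 𝒢.IsVerticiallySlim) (hE : (𝒢.inducedAlong ι).EveryEdgeAbuts) :
    IsAmbientObj ⟨⟨𝒢.inducedAlong ι⟩⟩ :=
  ⟨𝒢.inducedAlong_isTotallyAloof ι hι hA, ⟨fun w => hS.isSlim (ι.vertexMap w)⟩, hE⟩

/-- **`𝒢[v]` is an object of the ambient category** when `𝒢` is totally aloof and verticially slim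
(every edge of `𝔾[v]` abuts to its vertex). [cite: MochizukiSemiAnbd2006, Def 4.1, p. 50] -/
theorem isAmbientObj_atVertex (𝒢 : SemiGraphOfAnabelioids.{v₁, u₁, u}) (hA : 𝒢.IsTotallyAloof)
    (hS : 𝒢.IsVerticiallySlim) (v : 𝒢.graph.Vertex) : IsAmbientObj ⟨⟨𝒢.atVertex v⟩⟩ :=
  ⟨𝒢.atVertex_isTotallyAloof hA v, 𝒢.atVertex_isVerticiallySlim hS v, 𝒢.atVertex_everyEdgeAbuts v⟩

/-- **`𝒢[e]` is an object of the ambient category** when `𝒢` is (the edge `e` abutting to a vertex of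
`𝔾`, as every edge of an ambient object does). [cite: MochizukiSemiAnbd2006, Def 4.1, p. 50] -/
theorem isAmbientObj_atEdge (𝒢 : SemiGraphOfAnabelioids.{v₁, u₁, u}) (hA : 𝒢.IsTotallyAloof)
    (hS : 𝒢.IsVerticiallySlim) (hE : 𝒢.EveryEdgeAbuts) (e : 𝒢.graph.Edge) :
    IsAmbientObj ⟨⟨𝒢.atEdge e⟩⟩ :=
  ⟨𝒢.atEdge_isTotallyAloof hA e, 𝒢.atEdge_isVerticiallySlim hS e, 𝒢.atEdge_everyEdgeAbuts hE e⟩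

/-- **`𝒢[b]` is an object of the ambient category** when `𝒢` is totally aloof and verticially slim.
[cite: MochizukiSemiAnbd2006, Def 4.1, p. 50] -/
theorem isAmbientObj_atBranch (𝒢 : SemiGraphOfAnabelioids.{v₁, u₁, u}) (hA : 𝒢.IsTotallyAloof)
    (hS : 𝒢.IsVerticiallySlim) (b : 𝒢.graph.Branch) (hb : (𝒢.graph.abuts b).isSome) :
    IsAmbientObj ⟨⟨𝒢.atBranch b hb⟩⟩ :=
  ⟨𝒢.atBranch_isTotallyAloof hA b hb, 𝒢.atBranch_isVerticiallySlim hS b hb,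
    𝒢.atBranch_everyEdgeAbuts b hb⟩

/-- The localizations of an AMBIENT object are ambient objects: `X[v]`.
[cite: MochizukiSemiAnbd2006, Def 4.1, p. 50] -/
theorem isAmbientObj_atVertex_of (X : SgA.{v₁, u₁, u}) (v : X.toSgA.graph.Vertex) :
    IsAmbientObj ⟨⟨X.toSgA.atVertex v⟩⟩ :=
  isAmbientObj_atVertex X.toSgA X.property.1 X.property.2.1 v

/-- The localizations of an AMBIENT object are ambient objects: `X[e]`.
[cite: MochizukiSemiAnbd2006, Def 4.1, p. 50] -/
theorem isAmbientObj_atEdge_of (X : SgA.{v₁, u₁, u}) (e : X.toSgA.graph.Edge) :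
    IsAmbientObj ⟨⟨X.toSgA.atEdge e⟩⟩ :=
  isAmbientObj_atEdge X.toSgA X.property.1 X.property.2.1 X.property.2.2 e

/-- The localizations of an AMBIENT object are ambient objects: `X[b]`.
[cite: MochizukiSemiAnbd2006, Def 4.1, p. 50] -/
theorem isAmbientObj_atBranch_of (X : SgA.{v₁, u₁, u}) (b : X.toSgA.graph.Branch)
    (hb : (X.toSgA.graph.abuts b).isSome) : IsAmbientObj ⟨⟨X.toSgA.atBranch b hb⟩⟩ :=
  isAmbientObj_atBranch X.toSgA X.property.1 X.property.2.1 b hb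

end SgAQuot

end Literature.AnabelianGeometry.SemiGraphs
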